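import Summits.CriticalPhenomena.PercolationContinuityZ3.Theorems.PercNearOneGluingNoHeavyLowerTailIncStarTwoCutNearMerge
import HarnessLib

/-!
# Two-cuts with the root and one target on the root side (MODE B), VI-a: set algebra of the near lemma

Support file for the Sahi programme (`--supports stmt-CriticalPhenomena-4575`, prover prim-sahi-p2 gen 26).  No definitions, no named
facts, no sorries; standard axioms.  Memo `run/shared/lean/prim/prim-sahi/FROM-prim-sahi-p2-gen26-NEAR-LEMMA.md` §3.
Deterministic identities between the connection events of a root `s`, ports `x, y` and a target `a` used by the Harris rows of the near
lemma (`…IncStarTwoCutNearRows`): `Ω = X̂ ⊔ D_x ⊔ Z`, `R = Z ⊔ D₀`, `M′ = A ⊔ E_x ⊔ E_y ⊔ E_xy`, `M′ ∩ J = (A ⊔ E_x ⊔ E_y) ∩ J` for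
`J ⊆ X̂ ∪ Ŷ`, and the splittings of `D_x`, `E_x` along `{s ↔ y}`.
-/

noncomputable section

namespace Summit.CriticalPhenomena.PercolationContinuityZ3.Theorems

namespace IncStarTwoCut

open MeasureTheory Set Literature.Probability.Percolation Literature.Probability.LatticeModels
open scoped Classical

variable {V : Type}

section SetAlgebra

variable (s x y a : V)

/-- `Z = {x↔y} ∩ {x↮s}` equals `{x↔y} ∩ {y↮s}`. [folklore] -/
theorem Z_eq : (openConn x y ∩ (openConn x s)ᶜ : Set (BondConfig V)) = openConn x y ∩ (openConn y s)ᶜ := by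
  ext ω
  simp only [mem_inter_iff, mem_compl_iff, openConn, mem_setOf_eq]
  constructor
  · rintro ⟨hxy, hxs⟩; exact ⟨hxy, fun hys => hxs (hxy.trans hys)⟩
  · rintro ⟨hxy, hys⟩; exact ⟨hxy, fun hxs => hys (hxy.symm.trans hxs)⟩

/-- `Ω = X̂ ⊔ D_x ⊔ Z`: the three events are pairwise disjoint and cover. [folklore] -/
theorem univ_eq_X_Dx_Z :
    (univ : Set (BondConfig V)) = openConn s x ∪ ((openConn x s)ᶜ ∩ (openConn x y)ᶜ) ∪ (openConn x y ∩ (openConn x s)ᶜ) := by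
  ext ω
  simp only [mem_univ, mem_union, mem_inter_iff, mem_compl_iff, openConn, mem_setOf_eq, true_iff]
  by_cases h1 : (openGraph ω).Reachable s x
  · exact Or.inl (Or.inl h1)
  · by_cases h2 : (openGraph ω).Reachable x y
    · exact Or.inr ⟨h2, fun h => h1 h.symm⟩
    · exact Or.inl (Or.inr ⟨fun h => h1 h.symm, h2⟩)

/-- The port pair event `R = {x↮s} ∩ {y↮s}` splits as `Z ⊔ D₀`. [folklore] -/
theorem R_eq_Z_union_D0 :
    ((openConn x s)ᶜ ∩ (openConn y s)ᶜ : Set (BondConfig V)) =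
      (openConn x y ∩ (openConn x s)ᶜ) ∪ ((openConn x y)ᶜ ∩ (openConn x s)ᶜ ∩ (openConn y s)ᶜ) := by
  ext ω
  simp only [mem_inter_iff, mem_compl_iff, mem_union, openConn, mem_setOf_eq]
  constructor
  · rintro ⟨hxs, hys⟩
    by_cases hxy : (openGraph ω).Reachable x y
    · exact Or.inl ⟨hxy, hxs⟩
    · exact Or.inr ⟨⟨hxy, hxs⟩, hys⟩
  · rintro (⟨hxy, hxs⟩ | ⟨⟨_, hxs⟩, hys⟩)
    · exact ⟨hxs, fun hys => hxs (hxy.trans hys)⟩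
    · exact ⟨hxs, hys⟩

/-- On `R = {x↮s} ∩ {y↮s}`: `R ∩ {x↔y} = Z`. [folklore] -/
theorem R_inter_xy : ((openConn x s)ᶜ ∩ (openConn y s)ᶜ ∩ openConn x y : Set (BondConfig V)) = openConn x y ∩ (openConn x s)ᶜ := by
  ext ω
  simp only [mem_inter_iff, mem_compl_iff, openConn, mem_setOf_eq]
  constructor
  · rintro ⟨⟨hxs, _⟩, hxy⟩; exact ⟨hxy, hxs⟩
  · rintro ⟨hxy, hxs⟩; exact ⟨⟨hxs, fun hys => hxs (hxy.trans hys)⟩, hxy⟩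

/-- `R ∩ ({x↔y} ∩ M) = E_xy := Z ∩ {x↔a}` (`M = {x↔a} ∪ {y↔a}`). [folklore] -/
theorem R_inter_xy_M :
    ((openConn x s)ᶜ ∩ (openConn y s)ᶜ ∩ (openConn x y ∩ (openConn x a ∪ openConn y a)) : Set (BondConfig V))
      = openConn x y ∩ (openConn x s)ᶜ ∩ openConn x a := by
  ext ω
  simp only [mem_inter_iff, mem_compl_iff, mem_union, openConn, mem_setOf_eq]
  constructor
  · rintro ⟨⟨hxs, _⟩, hxy, (hxa | hya)⟩
    · exact ⟨⟨hxy, hxs⟩, hxa⟩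
    · exact ⟨⟨hxy, hxs⟩, hxy.trans hya⟩
  · rintro ⟨⟨hxy, hxs⟩, hxa⟩; exact ⟨⟨hxs, fun hys => hxs (hxy.trans hys)⟩, hxy, Or.inl hxa⟩

/-- `R ∩ M = E_xy ⊔ (D₀ ∩ {x↔a}) ⊔ (D₀ ∩ {y↔a})`. [folklore] -/
theorem R_inter_M :
    ((openConn x s)ᶜ ∩ (openConn y s)ᶜ ∩ (openConn x a ∪ openConn y a) : Set (BondConfig V))
      = (openConn x y ∩ (openConn x s)ᶜ ∩ openConn x a) ∪
        (((openConn x y)ᶜ ∩ (openConn x s)ᶜ ∩ (openConn y s)ᶜ ∩ openConn x a) ∪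
         ((openConn x y)ᶜ ∩ (openConn x s)ᶜ ∩ (openConn y s)ᶜ ∩ openConn y a)) := by
  ext ω
  simp only [mem_inter_iff, mem_compl_iff, mem_union, openConn, mem_setOf_eq]
  constructor
  · rintro ⟨⟨hxs, hys⟩, (hxa | hya)⟩
    · by_cases hxy : (openGraph ω).Reachable x y
      · exact Or.inl ⟨⟨hxy, hxs⟩, hxa⟩
      · exact Or.inr (Or.inl ⟨⟨⟨hxy, hxs⟩, hys⟩, hxa⟩)
    · by_cases hxy : (openGraph ω).Reachable x y
      · exact Or.inl ⟨⟨hxy, hxs⟩, hxy.trans hya⟩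
      · exact Or.inr (Or.inr ⟨⟨⟨hxy, hxs⟩, hys⟩, hya⟩)
  · rintro (⟨⟨hxy, hxs⟩, hxa⟩ | ⟨⟨⟨_, hxs⟩, hys⟩, hxa⟩ | ⟨⟨⟨_, hxs⟩, hys⟩, hya⟩)
    · exact ⟨⟨hxs, fun hys => hxs (hxy.trans hys)⟩, Or.inl hxa⟩
    · exact ⟨⟨hxs, hys⟩, Or.inl hxa⟩
    · exact ⟨⟨hxs, hys⟩, Or.inr hya⟩

/-- `D_x = D₀ ⊔ (D_x ∩ {s↔y})`. [folklore] -/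
theorem Dx_split :
    ((openConn x s)ᶜ ∩ (openConn x y)ᶜ : Set (BondConfig V))
      = ((openConn x y)ᶜ ∩ (openConn x s)ᶜ ∩ (openConn y s)ᶜ) ∪ ((openConn x s)ᶜ ∩ (openConn x y)ᶜ ∩ openConn s y) := by
  ext ω
  simp only [mem_inter_iff, mem_compl_iff, mem_union, openConn, mem_setOf_eq]
  constructor
  · rintro ⟨hxs, hxy⟩
    by_cases hsy : (openGraph ω).Reachable s y
    · exact Or.inr ⟨⟨hxs, hxy⟩, hsy⟩
    · exact Or.inl ⟨⟨hxy, hxs⟩, fun h => hsy h.symm⟩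
  · rintro (⟨⟨hxy, hxs⟩, hys⟩ | ⟨⟨hxs, hxy⟩, _⟩)
    · exact ⟨hxs, hxy⟩
    · exact ⟨hxs, hxy⟩

/-- `E_x = (D₀ ∩ {x↔a}) ⊔ (E_x ∩ {s↔y})`. [folklore] -/
theorem Ex_split :
    ((openConn x s)ᶜ ∩ (openConn x y)ᶜ ∩ openConn x a : Set (BondConfig V))
      = ((openConn x y)ᶜ ∩ (openConn x s)ᶜ ∩ (openConn y s)ᶜ ∩ openConn x a) ∪
        ((openConn x s)ᶜ ∩ (openConn x y)ᶜ ∩ (openConn x a ∩ openConn s y)) := by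
  ext ω
  simp only [mem_inter_iff, mem_compl_iff, mem_union, openConn, mem_setOf_eq]
  constructor
  · rintro ⟨⟨hxs, hxy⟩, hxa⟩
    by_cases hsy : (openGraph ω).Reachable s y
    · exact Or.inr ⟨⟨hxs, hxy⟩, hxa, hsy⟩
    · exact Or.inl ⟨⟨⟨hxy, hxs⟩, fun h => hsy h.symm⟩, hxa⟩
  · rintro (⟨⟨⟨hxy, hxs⟩, _⟩, hxa⟩ | ⟨⟨hxs, hxy⟩, hxa, _⟩)
    · exact ⟨⟨hxs, hxy⟩, hxa⟩
    · exact ⟨⟨hxs, hxy⟩, hxa⟩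

/-- For an event `J ⊆ X̂ ∪ Ŷ`: `J = (J ∩ X̂) ⊔ (J ∩ D_x)` (no configuration of `J` lies in `Z`). [folklore] -/
theorem J_split {J : Set (BondConfig V)} (hJ : J ⊆ openConn s x ∪ openConn s y) :
    J = (J ∩ openConn s x) ∪ (J ∩ ((openConn x s)ᶜ ∩ (openConn x y)ᶜ)) := by
  ext ω
  simp only [mem_union, mem_inter_iff, mem_compl_iff, openConn, mem_setOf_eq]
  constructor
  · intro hω
    by_cases hsx : (openGraph ω).Reachable s x
    · exact Or.inl ⟨hω, hsx⟩
    · refine Or.inr ⟨hω, fun h => hsx h.symm, fun hxy => hsx ?_⟩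
      rcases hJ hω with h | h
      · exact h
      · exact (show (openGraph ω).Reachable s y from h).trans hxy.symm
  · rintro (⟨hω, _⟩ | ⟨hω, _⟩) <;> exact hω

/-- For `J ⊆ X̂ ∪ Ŷ`: `M′ ∩ J = (A ⊔ E_x ⊔ E_y) ∩ J` with `M′ = {s↔a} ∪ {x↔a} ∪ {y↔a}`. [folklore] -/
theorem Mp_inter_J {J : Set (BondConfig V)} (hJ : J ⊆ openConn s x ∪ openConn s y) :
    ((openConn s a ∪ openConn x a ∪ openConn y a) ∩ J : Set (BondConfig V))
      = (openConn s a ∩ J) ∪ (((openConn x s)ᶜ ∩ (openConn x y)ᶜ ∩ openConn x a ∩ J) ∪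
          ((openConn y s)ᶜ ∩ (openConn y x)ᶜ ∩ openConn y a ∩ J)) := by
  ext ω
  simp only [mem_inter_iff, mem_union, mem_compl_iff, openConn, mem_setOf_eq]
  constructor
  · rintro ⟨(hsa | hxa) | hya, hω⟩
    · exact Or.inl ⟨hsa, hω⟩
    · by_cases hsa : (openGraph ω).Reachable s a
      · exact Or.inl ⟨hsa, hω⟩
      · have hxs : ¬ (openGraph ω).Reachable x s := fun h => hsa (h.symm.trans hxa)
        have hxy : ¬ (openGraph ω).Reachable x y := by
          intro hxy
          rcases hJ hω with h | h
          · exact hxs (show (openGraph ω).Reachable s x from h).symm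
          · exact hxs (hxy.trans (show (openGraph ω).Reachable s y from h).symm)
        exact Or.inr (Or.inl ⟨⟨⟨hxs, hxy⟩, hxa⟩, hω⟩)
    · by_cases hsa : (openGraph ω).Reachable s a
      · exact Or.inl ⟨hsa, hω⟩
      · have hys : ¬ (openGraph ω).Reachable y s := fun h => hsa (h.symm.trans hya)
        have hyx : ¬ (openGraph ω).Reachable y x := by
          intro hyx
          rcases hJ hω with h | h
          · exact hys (hyx.trans (show (openGraph ω).Reachable s x from h).symm)
          · exact hys (show (openGraph ω).Reachable s y from h).symm
        exact Or.inr (Or.inr ⟨⟨⟨hys, hyx⟩, hya⟩, hω⟩)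
  · rintro (⟨hsa, hω⟩ | ⟨⟨⟨_, hxa⟩, hω⟩⟩ | ⟨⟨⟨_, hya⟩, hω⟩⟩)
    · exact ⟨Or.inl (Or.inl hsa), hω⟩
    · exact ⟨Or.inl (Or.inr hxa), hω⟩
    · exact ⟨Or.inr hya, hω⟩

/-- `M′ = A ⊔ E_x ⊔ E_y ⊔ E_xy` as a union (the pieces are shown disjoint where used). [folklore] -/
theorem Mp_eq :
    (openConn s a ∪ openConn x a ∪ openConn y a : Set (BondConfig V))
      = openConn s a ∪ ((((openConn x s)ᶜ ∩ (openConn x y)ᶜ ∩ openConn x a) ∪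
          ((openConn y s)ᶜ ∩ (openConn y x)ᶜ ∩ openConn y a)) ∪ (openConn x y ∩ (openConn x s)ᶜ ∩ openConn x a)) := by
  ext ω
  simp only [mem_union, mem_inter_iff, mem_compl_iff, openConn, mem_setOf_eq]
  constructor
  · rintro ((hsa | hxa) | hya)
    · exact Or.inl hsa
    · by_cases hsa : (openGraph ω).Reachable s a
      · exact Or.inl hsa
      · have hxs : ¬ (openGraph ω).Reachable x s := fun h => hsa (h.symm.trans hxa)
        by_cases hxy : (openGraph ω).Reachable x y
        · exact Or.inr (Or.inr ⟨⟨hxy, hxs⟩, hxa⟩)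
        · exact Or.inr (Or.inl (Or.inl ⟨⟨hxs, hxy⟩, hxa⟩))
    · by_cases hsa : (openGraph ω).Reachable s a
      · exact Or.inl hsa
      · have hys : ¬ (openGraph ω).Reachable y s := fun h => hsa (h.symm.trans hya)
        by_cases hxy : (openGraph ω).Reachable x y
        · exact Or.inr (Or.inr ⟨⟨hxy, fun h => hys (hxy.symm.trans h)⟩, hxy.trans hya⟩)
        · exact Or.inr (Or.inl (Or.inr ⟨⟨hys, fun h => hxy h.symm⟩, hya⟩))
  · rintro (hsa | ((⟨_, hxa⟩ | ⟨_, hya⟩) | ⟨_, hxa⟩))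
    · exact Or.inl (Or.inl hsa)
    · exact Or.inl (Or.inr hxa)
    · exact Or.inr hya
    · exact Or.inl (Or.inr hxa)

end SetAlgebra

end IncStarTwoCut

end Summit.CriticalPhenomena.PercolationContinuityZ3.Theorems
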